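import Summits.AnomalousDissipation.AnomalousDissipation.Theorems.UniformRelaxationWitness.Negative.SeisWindowCore
import Literature.Analysis.FluidPDE.LongTimeAverageSlidingWindow
import Literature.Analysis.FluidPDE.PassiveScalarReleaseExistence
import Summits.AnomalousDissipation.AnomalousDissipation.Theorems.RelaxingFamily.Negative.LinearEnstrophyBudget
import HarnessLib

/-!
# Negative knowledge for the crux `UniformRelaxationWitness` (stmt-AnomalousDissipation-2937), III:
# Seis' dissipation-rate bound needs the drift only on the dissipation horizon

Refuter (cdisprove) helper for the Seis floors of
`Summit.AnomalousDissipation.AnomalousDissipation.Theses.LimitingAbsorption.UniformRelaxationWitness` and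
`…RelaxingFamily` (supports stmt-AnomalousDissipation-2937). The vendored fact
`Literature.Analysis.FluidPDE.Seis2022_rmk1_L2` (discharged in the tree) asks for the drift `u` to be
essentially bounded in energy on ALL of `(0, ∞)`, the linear strain budget `∫₀ᵗ‖∇u‖₂ ≤ M(1+t)` for ALL
`t > 0`, a weak solution on every `[0,T)` and the decay `‖θ(t)‖₂ ≤ C₀e^{-Dt}` for a.e. `t > 0`; but the
printed proof (Seis 2022 §2.2) — and the tree's `seis_core` — only ever look at the dissipation horizon
`(0, T_N)`, `T_N = (N+1)/D + 2` with `N = ⌈log(32 C₀/a)⌉` INDEPENDENT of `κ` and of the drift. For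
Navier–Stokes drifts this matters: a global Leray–Hopf solution is essentially bounded in energy on every
FINITE window (the interface field `energy_bound`), while a uniform-in-time bound is not in the tree.

* (`SeisWindowCore.lean`) `seis_core_window` — the tree's `seis_core`, hypotheses restricted to `(0, T_N)`.
* `seis_rmk1_window` — **Seis 2022, Remark 1, windowed form**: for data constants `a, B, C₀, M` there are
  `κ₀ ∈ (0,1)`, `K ≥ 0` and `N : ℕ` such that for `κ ≤ κ₀`, `0 < D ≤ 1` and `T := (N+1)/D + 2`: a drift
  in `L^∞(0,T;L²)` with `∫₀ᵀ‖∇u‖₂ ≤ M(1+T)`, a smooth mean-zero datum with `a ≤ ‖θ₀‖₁`, `‖∇θ₀‖₁ ≤ B`, a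
  weak solution on `[0,T)` decaying like `(C₀e^{-Dt})²` a.e. on `(0,T)` force `D ≤ K / log(1/κ)`.
* `seisN`, `seisHorizon` — Seis' e-folding count `⌈log(32C₀/a)⌉` and horizon `(N+1)/D + 2`: functions
  of the PROFILE data and the rate only (not of the drift or its strain bound).
* `TamePhases g h ν v` — for every window length `L` a bound `R_L` (arbitrary dependence on `L`) such that
  every level has SOME phase `s ≥ 0` with `∫₀ᴸ ‖∇v_j(s + τ)‖_{L²} dτ ≤ R_L`; `WindowedStrainBudget` (one
  slope, `R_L = M(1+L)`) and `InitiallyTame` (phase `0`: `j`-uniformly bounded strain on every initial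
  window) are sub-classes. No energy clause anywhere (finite-window energy bounds are automatic for
  Leray–Hopf drifts, `exists_energy_bound_shift`).
* `relaxingFamily_false_with_tamePhases : ¬ RelaxingFamilyUnder TamePhases` — UNCONDITIONAL: a witness of
  crux r3 (hence of r2 = X, by `UniformRelaxationWitnessUnder.relaxingFamilyUnder` of `SeisTransfer.lean`)
  has a window length `L*` (Seis' horizon for its profile data) such that
  `sup_j inf_{s ≥ 0} ∫ₛ^{s+L*} ‖∇v_j‖₂ = ∞`: at suitable levels EVERY window of length `L*` is wild.
  Corollaries `relaxingFamily_false_without_superlinearWindowedStrain` (sharpening of the landed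
  `relaxingFamily_false_without_superlinearEnstrophy`: no uniform-in-time energy hypothesis, no budget at
  all times — the receptacle for time-averaged enstrophy bounds reached through a good-phase selection,
  e.g. single-shell forcing) and `relaxingFamily_false_with_initiallyTame` ("data must be pre-stirred").

## References

* C. Seis, Comm. Math. Phys. 399 (2023) 2071–2081 = arXiv:2003.08794, Thm. 2, Rmk. 1, §2.2. [`Seis2022`]
-/

noncomputable section

open MeasureTheory Set Filter Metric Function Topology
open scoped ENNReal NNReal Topology InnerProductSpace Convolution
open Literature.Analysis.FunctionSpaces Literature.Analysis.FunctionSpaces.Torus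
open Literature.Analysis.SingularIntegrals Literature.Analysis.SingularIntegrals.Torus
open Literature.Analysis.FluidPDE Literature.Analysis.FluidPDE.Torus

namespace Summit.AnomalousDissipation.AnomalousDissipation.Theorems.UniformRelaxationWitness.Negative

-- D-0017: single-problem summit ⇒ `Summit.AnomalousDissipation.AnomalousDissipation.…` by design.
set_option linter.dupNamespace false

variable {d : Type*} [Fintype d] [DecidableEq d]

/-! ## Seis 2022, Remark 1 — windowed form -/

/-- The number of e-foldings Seis' argument waits for: `N = ⌈log(32 C₀ / a)⌉` (depends on the datum's
`L¹` mass `a` and the decay prefactor `C₀` only — not on `κ`, the rate or the drift). -/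
def seisN (a C₀ : ℝ) : ℕ := ⌈Real.log (32 * C₀ / a)⌉₊

/-- The dissipation horizon `T = (N+1)/D + 2` of Seis' argument at rate `D`. -/
def seisHorizon (a C₀ D : ℝ) : ℝ := ((seisN a C₀ : ℝ) + 1) / D + 2

/-- The horizon is positive for `D > 0`. [folklore] -/
theorem seisHorizon_pos {a C₀ D : ℝ} (hD : 0 < D) : 0 < seisHorizon a C₀ D := by
  unfold seisHorizon; positivity

/-- **Seis 2022, Remark 1 (`p = q = r = 2`), windowed form.** For every dimension and constants
`a > 0`, `B`, `C₀ > 0`, `M ≥ 0` there are `κ₀ ∈ (0,1)` and `K ≥ 0` such that for all `κ ∈ (0, κ₀]`,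
every rate `0 < D ≤ 1` and the horizon `T = seisHorizon a C₀ D = (N+1)/D + 2`, `N = seisN a C₀`: every
drift `u` essentially bounded in energy on `(0,T)` with `∫⁻_{(0,T)} ‖∇u‖₂ ≤ M(1+T)`, every smooth
mean-zero datum with `a ≤ ‖θ₀‖₁`, `‖∇θ₀‖₁ ≤ B`, and every weak solution `θ` on `[0,T)` with
`‖θ(t)‖²₂ ≤ (C₀ e^{-Dt})²` for a.e. `t ∈ (0,T)` satisfy `D ≤ K / log(1/κ)`. The horizon does not depend
on `M` (only `K` does), which is what lets windowed strain bounds with window-dependent constants be fed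
in. (The tree's discharge of `Seis2022_rmk1_L2`, run on the window.) [cite: Seis2022, Remark 1 (p. 4); Thm 2, proof §2.2 (pp. 7–8)] -/
theorem seis_rmk1_window (a B C₀ M : ℝ) (ha : 0 < a) (hC₀ : 0 < C₀) (hM : 0 ≤ M) :
    ∃ κ₀ K : ℝ, 0 < κ₀ ∧ κ₀ < 1 ∧ 0 ≤ K ∧
      ∀ (κ D : ℝ) (u : ℝ → UnitAddTorus d → EuclideanSpace ℝ d) (θ₀ : UnitAddTorus d → ℝ)
        (θ : ℝ → UnitAddTorus d → ℝ),
        0 < κ → κ ≤ κ₀ → 0 < D → D ≤ 1 →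
        (∃ Mv : ℝ≥0, ∀ᵐ t ∂((volume : Measure ℝ).restrict (Ioo 0 (seisHorizon a C₀ D))),
          ∫⁻ x, ‖u t x‖ₑ ^ 2 ≤ Mv) →
        (∫⁻ τ in Ioo 0 (seisHorizon a C₀ D), eGradNormSq (u τ) ^ (1 / 2 : ℝ) ≤
          ENNReal.ofReal (M * (1 + seisHorizon a C₀ D))) →
        IsSmooth θ₀ → HasZeroMean θ₀ → a ≤ ∫ x, |θ₀ x| → ∫ x, ‖Torus.gradient θ₀ x‖ ≤ B →
        Torus.IsWeakScalarTransportOn (seisHorizon a C₀ D) κ u θ₀ θ →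
        (∀ᵐ t ∂((volume : Measure ℝ).restrict (Ioo 0 (seisHorizon a C₀ D))),
            Torus.scalarL2Sq (θ t) ≤ (C₀ * Real.exp (-(D * t))) ^ 2) →
        D ≤ K / Real.log κ⁻¹ := by
  classical
  -- constants (as in the tree's discharge of `Seis2022_rmk1_L2`)
  set g : ℝ := seisMod d (max B 0) with hg
  have hg0 : 0 < g := seisMod_pos d (le_max_right _ _)
  set x₀ : ℝ := min (a / 2 / g) 1 with hx₀
  have hx₀0 : 0 < x₀ := lt_min (by positivity) one_pos
  set C₄ : ℝ := lemma4Const d with hC₄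
  set N : ℕ := seisN a C₀ with hN
  set E₂ : ℝ := seisE2 d C₀ M with hE₂
  have hE₂0 : 0 ≤ E₂ := seisE2_nonneg d hC₀.le hM
  set E₁ : ℝ := a / 16 * |Real.log (x₀ / C₄)| with hE₁
  have hE₁0 : 0 ≤ E₁ := by positivity
  set K : ℝ := 128 * (E₂ * ((N : ℝ) + 4) + 1) / a with hK
  have hK0 : 0 ≤ K := by positivity
  set κ₀ : ℝ := min (min (1 / 16) ((a / (2 * g)) ^ 2))
    (min (Real.exp (-(128 * E₁ / a))) (Real.exp (-(K + 1)))) with hκ₀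
  have hκ₀0 : 0 < κ₀ :=
    lt_min (lt_min (by norm_num) (by positivity)) (lt_min (Real.exp_pos _) (Real.exp_pos _))
  have hκ₀1 : κ₀ < 1 := (min_le_left _ _).trans_lt ((min_le_left _ _).trans_lt (by norm_num))
  refine ⟨κ₀, K, hκ₀0, hκ₀1, hK0, ?_⟩
  intro κ D u θ₀ θ hκ hκκ₀ hD0 hD1 hu2 hgrad hθ₀ hmean ha' hB' hsol hdecay
  simp only [seisHorizon] at hu2 hgrad hsol hdecay
  rw [← hN] at hu2 hgrad hsol hdecay
  -- facts about `κ`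
  have hκ16 : κ ≤ 1 / 16 := hκκ₀.trans ((min_le_left _ _).trans (min_le_left _ _))
  have hκa : κ ≤ (a / (2 * g)) ^ 2 := hκκ₀.trans ((min_le_left _ _).trans (min_le_right _ _))
  have hκE₁ : κ ≤ Real.exp (-(128 * E₁ / a)) := hκκ₀.trans ((min_le_right _ _).trans (min_le_left _ _))
  have hκK : κ ≤ Real.exp (-(K + 1)) := hκκ₀.trans ((min_le_right _ _).trans (min_le_right _ _))
  have hlogκ : 0 < Real.log κ⁻¹ := Real.log_pos (by rw [lt_inv_comm₀ one_pos hκ, inv_one]; linarith)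
  have hlog_ge : ∀ {y : ℝ}, κ ≤ Real.exp (-y) → y ≤ Real.log κ⁻¹ := fun {y} hy => by
    rw [Real.log_inv, le_neg, ← Real.log_exp (-y)]
    exact Real.log_le_log hκ hy
  -- degenerate dimension
  rcases isEmpty_or_nonempty d with hd | hd
  · exfalso
    have := integral_abs_eq_zero_of_isEmpty (d := d) hmean
    linarith
  have hC₄0 : 0 < C₄ := lemma4Const_pos
  -- `δ = √κ`
  set δ : ℝ := Real.sqrt κ with hδdef
  have hδ : 0 < δ := Real.sqrt_pos.2 hκ
  have hκδ : κ = δ ^ 2 := (Real.sq_sqrt hκ.le).symm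
  have hδ4 : δ ≤ 1 / 4 := by
    rw [hδdef, show (1 / 4 : ℝ) = Real.sqrt (1 / 16) by
      rw [show (1 / 16 : ℝ) = (1 / 4) ^ 2 by norm_num, Real.sqrt_sq (by norm_num)]]
    exact Real.sqrt_le_sqrt hκ16
  have hδa : δ ≤ a / (2 * g) := by
    rw [hδdef, ← Real.sqrt_sq (by positivity : 0 ≤ a / (2 * g))]
    exact Real.sqrt_le_sqrt hκa
  have hlogδ : Real.log δ⁻¹ = Real.log κ⁻¹ / 2 := by
    rw [Real.log_inv, Real.log_inv, hδdef, Real.log_sqrt hκ.le]; ring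
  -- `N`
  have hN' : C₀ * Real.exp (-(N : ℝ)) ≤ a / 32 := by
    have h1 : Real.log (32 * C₀ / a) ≤ N := by rw [hN]; exact Nat.le_ceil _
    have h2 : 32 * C₀ / a ≤ Real.exp (N : ℝ) := by
      rw [← Real.exp_log (by positivity : 0 < 32 * C₀ / a)]
      exact Real.exp_le_exp.2 h1
    have hpos := Real.exp_pos (N : ℝ)
    rw [div_le_iff₀ ha] at h2
    rw [Real.exp_neg, le_div_iff₀ (by norm_num : (0 : ℝ) < 32),
      show C₀ * (Real.exp (N : ℝ))⁻¹ * 32 = (32 * C₀) / Real.exp (N : ℝ) by ring, div_le_iff₀ hpos]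
    linarith [h2, mul_comm (Real.exp (N : ℝ)) a]
  -- data facts
  obtain ⟨M', hM'⟩ := hu2
  have hu2' : ∀ᵐ t ∂((volume : Measure ℝ).restrict (Ioo 0 (((N : ℝ) + 1) / D + 2))),
      ∫⁻ x, ‖u t x‖ₑ ^ 2 ≤ ENNReal.ofReal (M' : ℝ) := by
    simpa only [ENNReal.ofReal_coe_nnreal] using hM'
  have hB'' : ∫ x, ‖Torus.gradient θ₀ x‖ ≤ max B 0 := hB'.trans (le_max_left _ _)
  -- the core at rate `D ≤ 1` on the window, and the endgame
  have hcore := seis_core_window (d := d) ha (le_max_right B 0) hC₀ hM (NNReal.coe_nonneg M') hD0 hδ hκδ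
    hδ4 hδa N hu2' hgrad hθ₀ hmean ha' hB'' hsol hdecay
  have hmain : a / 32 * Real.log δ⁻¹ - E₁ ≤ (E₂ * ((N : ℝ) + 4) + 1) / D :=
    endgame_algebra ha hC₀ hC₄0 hx₀0 hE₂0 hD0 hD1 hδ hδ4 hN' hcore
  have hℓE₁ : 128 * E₁ / a ≤ Real.log κ⁻¹ := hlog_ge hκE₁
  have hkey : D * Real.log κ⁻¹ ≤ K := by
    rw [hlogδ] at hmain
    have h1 : E₁ ≤ a / 128 * Real.log κ⁻¹ := by
      rw [div_le_iff₀ ha] at hℓE₁; linarith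
    have h2 : a / 128 * Real.log κ⁻¹ ≤ (E₂ * ((N : ℝ) + 4) + 1) / D := by linarith
    rw [le_div_iff₀ hD0] at h2
    rw [hK, le_div_iff₀ ha]
    nlinarith
  rw [le_div_iff₀ hlogκ]
  exact hkey


/-! ## The windowed strain class and the sharpened Seis floor for `RelaxingFamily` -/

section Planar

open Summit.AnomalousDissipation.AnomalousDissipation.Theses.LimitingAbsorption
open Summit.AnomalousDissipation.AnomalousDissipation.Theorems.RelaxingFamily.Negative

/-- The unit flat 2-torus (local notation). -/
local notation "𝕋²" => UnitAddTorus (Fin 2)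
/-- Planar vectors (local notation). -/
local notation "E²" => EuclideanSpace ℝ (Fin 2)

/-- **Windowed strain budget**: one slope `M ≥ 0` such that for every level `j` and every window
length `L > 0` some phase `s ≥ 0` has `∫₀ᴸ ‖∇v_j(s + τ)‖_{L²} dτ ≤ M (1 + L)`
(`‖∇w‖_{L²} = (eGradNormSq w)^{1/2}`). -/
def WindowedStrainBudget (_g : 𝕋² → E²) (_h : 𝕋² → ℝ) (_ν : ℕ → ℝ) (v : ℕ → ℝ → 𝕋² → E²) : Prop :=
  ∃ M : ℝ, 0 ≤ M ∧ ∀ (j : ℕ) (L : ℝ), 0 < L → ∃ s : ℝ, 0 ≤ s ∧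
    ∫⁻ τ in Ioo 0 L, eGradNormSq (v j (s + τ)) ^ (1 / 2 : ℝ) ≤ ENNReal.ofReal (M * (1 + L))

/-- **Tame phases**: for every window length `L > 0` there is a bound `R` (depending on `L` in any way)
such that every level `j` has SOME phase `s ≥ 0` with windowed strain `∫₀ᴸ ‖∇v_j(s + τ)‖_{L²} dτ ≤ R`.
Its negation: for some window length `L*`, `sup_j inf_{s ≥ 0} ∫ₛ^{s+L*} ‖∇v_j‖₂ = ∞` — at suitable levels
EVERY window of length `L*` is wild. -/
def TamePhases (_g : 𝕋² → E²) (_h : 𝕋² → ℝ) (_ν : ℕ → ℝ) (v : ℕ → ℝ → 𝕋² → E²) : Prop :=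
  ∀ L : ℝ, 0 < L → ∃ R : ℝ, ∀ j : ℕ, ∃ s : ℝ, 0 ≤ s ∧
    ∫⁻ τ in Ioo 0 L, eGradNormSq (v j (s + τ)) ^ (1 / 2 : ℝ) ≤ ENNReal.ofReal R

/-- **Initially tame strain**: for every window length `L > 0` the strain on the INITIAL window
`∫₀ᴸ ‖∇v_j(τ)‖_{L²} dτ` is bounded uniformly in `j` (cold / laminar / `j`-uniformly smooth starts). -/
def InitiallyTame (_g : 𝕋² → E²) (_h : 𝕋² → ℝ) (_ν : ℕ → ℝ) (v : ℕ → ℝ → 𝕋² → E²) : Prop :=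
  ∀ L : ℝ, 0 < L → ∃ R : ℝ, ∀ j : ℕ,
    ∫⁻ τ in Ioo 0 L, eGradNormSq (v j τ) ^ (1 / 2 : ℝ) ≤ ENNReal.ofReal R

/-- A windowed strain budget gives tame phases. [folklore] -/
theorem tamePhases_of_windowedStrainBudget {g : 𝕋² → E²} {h : 𝕋² → ℝ} {ν : ℕ → ℝ}
    {v : ℕ → ℝ → 𝕋² → E²} (hB : WindowedStrainBudget g h ν v) : TamePhases g h ν v := by
  obtain ⟨M, -, hb⟩ := hB
  exact fun L hL => ⟨M * (1 + L), fun j => hb j L hL⟩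

/-- A linear windowed enstrophy budget from some phase on is a windowed strain budget (same slope,
same phase for every window). [folklore] -/
theorem windowedStrainBudget_of_linearEnstrophyBudget {g : 𝕋² → E²} {h : 𝕋² → ℝ} {ν : ℕ → ℝ}
    {v : ℕ → ℝ → 𝕋² → E²} (hB : LinearEnstrophyBudget g h ν v) : WindowedStrainBudget g h ν v := by
  obtain ⟨M, hM, hb⟩ := hB
  refine ⟨M, hM, fun j L hL => ?_⟩
  obtain ⟨s, hs, -, hbud⟩ := hb j
  exact ⟨s, hs, hbud L hL⟩

/-- Initially tame strain gives tame phases (phase `0`). [folklore] -/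
theorem tamePhases_of_initiallyTame {g : 𝕋² → E²} {h : 𝕋² → ℝ} {ν : ℕ → ℝ}
    {v : ℕ → ℝ → 𝕋² → E²} (hI : InitiallyTame g h ν v) : TamePhases g h ν v := by
  intro L hL
  obtain ⟨R, hR⟩ := hI L hL
  refine ⟨R, fun j => ⟨0, le_rfl, ?_⟩⟩
  simpa only [zero_add] using hR j

/-- **Finite-window energy bounds are automatic for Leray–Hopf drifts**: for `s ≥ 0`, `T > 0` the
shifted drift `u(s + ·)` is essentially bounded in energy on `(0,T)` (the interface field
`energy_bound` on `(0, s + T)`, transported along `t ↦ s + t`). [folklore] -/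
theorem exists_energy_bound_shift {ν : ℝ} {f : ℝ → 𝕋² → E²} {u₀ : 𝕋² → E²} {u : ℝ → 𝕋² → E²}
    (hu : IsGlobalLerayHopf ν f u₀ u) {s T : ℝ} (hs : 0 ≤ s) (hT : 0 < T) :
    ∃ M : ℝ≥0, ∀ᵐ t ∂((volume : Measure ℝ).restrict (Ioo 0 T)), ∫⁻ x, ‖u (s + t) x‖ₑ ^ 2 ≤ M := by
  obtain ⟨M, hM⟩ := (hu (s + T) (by linarith)).energy_bound
  refine ⟨M, ae_restrict_Ioo_add_left s (P := fun t => ∫⁻ x, ‖u t x‖ₑ ^ 2 ≤ M) ?_⟩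
  rw [add_zero]
  exact ae_restrict_of_ae_restrict_of_subset (Ioo_subset_Ioo hs le_rfl) hM

/-- **`RelaxingFamily` is false with tame phases** (Seis' floor on the dissipation horizon,
unconditional): a witness of crux r3 has a window length `L*` such that for every `R` some level `j` has
windowed strain `∫ₛ^{s+L*} ‖∇v_j‖₂ > R` from EVERY phase `s ≥ 0`. Proof: rate `D = min(γ/2, 1)`, horizon
`T = seisHorizon(‖h‖₁, C₀, D)` from the profile data ALONE, the class' bound `R` for the window `T`, Seis'
windowed constants `(κ₀, K)` for slope `M = max R 0`, the level `j` with `ν_j ≤ κ₀` and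
`log(1/ν_j) > K/D + 1`, the class' phase `s` at level `j`; the release of `h` into `v_j(s + ·)` on
`[0,T)` exists (`IsGlobalLerayHopf.exists_release`), the drift is bounded in energy on the window
(`exists_energy_bound_shift`), the crux's clause gives the decay on `(0,T)`, and `seis_rmk1_window` gives
`D ≤ K/log(1/ν_j)`, contradiction. [cite: Seis2022, Thm 2 and Remark 1 (arXiv:2003.08794 pp. 3–4)] -/
theorem relaxingFamily_false_with_tamePhases : ¬ RelaxingFamilyUnder TamePhases := by
  rintro ⟨g, h, -, -, -, hh, hhm, hh0, ν, v₀, v, hν, hνlim, hLH, -, -, htame, C, γ, hC, hγ, hrelax⟩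
  -- profile constants
  have ha : 0 < ∫ x, |h x| := integral_abs_pos_of_ne_zero hh hh0
  have hS : 0 < scalarL2Sq h := scalarL2Sq_pos_of_ne_zero hh hh0
  set C₀ : ℝ := Real.sqrt ((C + 1) * scalarL2Sq h) with hC₀def
  have hC₀sq : C₀ ^ 2 = (C + 1) * scalarL2Sq h := Real.sq_sqrt (by positivity)
  have hC₀ : 0 < C₀ := Real.sqrt_pos.2 (by positivity)
  -- the rate and the horizon (profile data only)
  set D : ℝ := min (γ / 2) 1 with hD
  have hD0 : 0 < D := lt_min (by positivity) one_pos
  have hD1 : D ≤ 1 := min_le_right _ _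
  have hDγ : D ≤ γ / 2 := min_le_left _ _
  set T : ℝ := seisHorizon (∫ x, |h x|) C₀ D with hT
  have hT0 : 0 < T := seisHorizon_pos hD0
  -- the class' bound for this window, and Seis' constants for that slope
  obtain ⟨R, hR⟩ := htame T hT0
  set M : ℝ := max R 0 with hMdef
  have hM : 0 ≤ M := le_max_right _ _
  obtain ⟨κ₀, K, hκ₀, -, hK, hSeis⟩ :=
    seis_rmk1_window (d := Fin 2) (∫ x, |h x|) (∫ x, ‖Torus.gradient h x‖) C₀ M ha hC₀ hM
  -- the level `j`: `ν_j ≤ κ₀` and `log (1/ν_j) > K/D + 1`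
  set L₀ : ℝ := K / D + 1 with hL₀
  have hL₀pos : 0 < L₀ := by
    have : 0 ≤ K / D := by positivity
    linarith
  obtain ⟨j, hj⟩ : ∃ j, ν j < min κ₀ (Real.exp (-L₀)) :=
    (hνlim.eventually (gt_mem_nhds (lt_min hκ₀ (Real.exp_pos _)))).exists
  have hνκ : ν j ≤ κ₀ := (hj.trans_le (min_le_left _ _)).le
  have hlog : L₀ < Real.log (ν j)⁻¹ := by
    rw [Real.log_inv]
    have h1 : Real.log (ν j) < Real.log (Real.exp (-L₀)) :=
      Real.log_lt_log (hν j) (hj.trans_le (min_le_right _ _))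
    rw [Real.log_exp] at h1
    linarith
  -- the phase at level `j` and its budget
  obtain ⟨s, hs, hbudR⟩ := hR j
  have hbud : ∫⁻ τ in Ioo 0 T, eGradNormSq (v j (s + τ)) ^ (1 / 2 : ℝ) ≤
      ENNReal.ofReal (M * (1 + T)) := by
    refine hbudR.trans (ENNReal.ofReal_le_ofReal ?_)
    have h1 : R ≤ M := le_max_left _ _
    nlinarith [hT0.le, hM]
  -- energy on the window, a release on `[0,T)`, its decay on `(0,T)`
  obtain ⟨Mv, hMv⟩ := exists_energy_bound_shift (hLH j) hs hT0
  obtain ⟨θ, hθ, -⟩ := (hLH j).exists_release (hν j) hT0 hs (hh.memLp 2)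
  have hdec : ∀ᵐ t ∂((volume : Measure ℝ).restrict (Ioo 0 T)),
      scalarL2Sq (θ t) ≤ (C₀ * Real.exp (-(D * t))) ^ 2 := by
    filter_upwards [hrelax j s hs T θ hθ, ae_restrict_mem measurableSet_Ioo] with t ht ht0
    have hexp : Real.exp (-(γ * t)) ≤ Real.exp (-(2 * D * t)) :=
      Real.exp_le_exp.2 (by nlinarith [ht0.1])
    have e1 : (C₀ * Real.exp (-(D * t))) ^ 2 = (C + 1) * scalarL2Sq h * Real.exp (-(2 * D * t)) := by
      rw [mul_pow, hC₀sq, sq (Real.exp _), ← Real.exp_add]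
      congr 1
      ring
    rw [e1]
    have hE : 0 ≤ Real.exp (-(2 * D * t)) := (Real.exp_pos _).le
    calc scalarL2Sq (θ t) ≤ C * Real.exp (-(γ * t)) * scalarL2Sq h := ht
      _ ≤ C * Real.exp (-(2 * D * t)) * scalarL2Sq h := by gcongr
      _ ≤ (C + 1) * scalarL2Sq h * Real.exp (-(2 * D * t)) := by nlinarith [hS.le]
  -- Seis on the window at rate `D`
  have hDle : D ≤ K / Real.log (ν j)⁻¹ :=
    hSeis (ν j) D (fun t => v j (s + t)) h θ (hν j) hνκ hD0 hD1 ⟨Mv, hMv⟩ hbud hh hhm le_rfl le_rfl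
      hθ hdec
  -- contradiction with the choice of `j`
  have hLpos : 0 < Real.log (ν j)⁻¹ := hL₀pos.trans hlog
  rw [le_div_iff₀ hLpos] at hDle
  have h1 : D * L₀ < D * Real.log (ν j)⁻¹ := mul_lt_mul_of_pos_left hlog hD0
  have h2 : D * L₀ = K + D := by rw [hL₀]; field_simp
  linarith

/-- **`RelaxingFamily` is false without super-linear WINDOWED strain** (corollary): no witness of crux
r3 admits one slope `M` such that every level and every window length have a phase with
`∫₀ᴸ‖∇v_j(s+τ)‖₂ dτ ≤ M(1+L)` — sharpening of the landed `relaxingFamily_false_without_superlinearEnstrophy`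
(no uniform-in-time energy hypothesis, no budget at all times). [cite: Seis2022, Remark 1 (arXiv:2003.08794 p. 4)] -/
theorem relaxingFamily_false_without_superlinearWindowedStrain :
    ¬ RelaxingFamilyUnder WindowedStrainBudget := fun hR =>
  relaxingFamily_false_with_tamePhases (hR.mono fun _ _ _ _ => tamePhases_of_windowedStrainBudget)

/-- **`RelaxingFamily` is false with initially tame strain** (corollary; "the data must be pre-stirred"):
since (U_h) is demanded from phase `0`, no witness of crux r3 has `j`-uniformly bounded strain
`∫₀ᴸ‖∇v_j‖₂` on every initial window — cold, laminar or `j`-uniformly smooth starts are dead; at some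
level the FIRST window of some fixed length already carries arbitrarily large strain. [cite: Seis2022, Remark 1 (arXiv:2003.08794 p. 4)] -/
theorem relaxingFamily_false_with_initiallyTame :
    ¬ RelaxingFamilyUnder InitiallyTame := fun hR =>
  relaxingFamily_false_with_tamePhases (hR.mono fun _ _ _ _ => tamePhases_of_initiallyTame)

end Planar

end Summit.AnomalousDissipation.AnomalousDissipation.Theorems.UniformRelaxationWitness.Negative

end
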